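import Literature.Topology.FourManifolds.TautFoliationsLeafTopology
import Mathlib.Topology.Order.IntermediateValue
import Mathlib.Order.Filter.Germ.Basic
import HarnessLib

/-!
# The holonomy cocycle of a `C⁰` codimension-one foliation

Sibling of `TautFoliationsPlaques.lean` and `TautFoliationsLeafTopology.lean`. For a `C⁰`
codimension-one foliation `F : Literature.Topology.FourManifolds.Foliation B M` (foliated atlas of flow
boxes `e : M ⊇ e.source ≃ B × ℝ` with plaque preserving changes of coordinates) this file
develops the **local holonomy transformations** between the transversals of two flow boxes —
the germs `γᵢⱼ` of the foliated cocycle (Hector–Hirsch, *Introduction to the Geometry of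
Foliations, Part A*, Ch. II 2.1.4: "the local homeomorphisms `γᵢⱼ` … satisfying the cocycle
condition"; Ch. III 2.2.1: holonomy by means of foliated cocycles, "the holonomy of `L` is
obtained by composing the `γᵢⱼ` along chains of plaques"; Camacho–Lins Neto, *Geometric Theory
of Foliations*, Ch. IV §1) — in the `C⁰` setting, where they are germs of homeomorphisms of
`ℝ` read on the *verticals* of the flow boxes:

* `Foliation.vertical e b` (**definition**): the vertical `τ ↦ e.symm (b, τ)` of the flow box
  `e` through the `B`-coordinate `b`, a continuous injective transversal crossing the plaque of
  height `τ` at the parameter `τ`.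
* `Foliation.transition e e' z` (**definition**): the **height transition** from `e` to `e'` at
  `z`, `τ ↦ h_{e'} (e.symm ((e z).1, τ))` — the `e'`-height of the point of the vertical of
  `e` through `z` at `e`-height `τ`. At the height of `z` it takes the value `h_{e'}(z)`
  (`transition_apply_height`); `transition e e z = id`.
* **Germ properties** (all as eventual equalities at the base height, `=ᶠ[𝓝 t]`):
  the transition germ is *locally constant along the plaque* (`eventually_transition_eventuallyEq`,
  `transition_eventuallyEq_of_isPreconnected`: moving `z` inside a connected piece of
  `plaque e t ∩ e'.source` does not change the germ — this is the compatibility condition of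
  the atlas), satisfies the **cocycle identity** `γ_{e'e''} ∘ γ_{ee'} = γ_{ee''}`
  (`transition_comp_eventuallyEq`) and has the inverse germ `γ_{e'e}`
  (`transition_symm_comp_eventuallyEq`); it is continuous at the base height
  (`continuousAt_transition`).
* **The transition germs are germs of homeomorphisms of `ℝ`**: on a small interval around the
  base height `transition e e' z` is injective, hence strictly monotone
  (`exists_strictMonoOn_or_strictAntiOn_transition`), and *increasing* when the atlas is
  transversely oriented (`IsTransverselyOriented.exists_strictMonoOn_transition`; Hector–Hirsch
  A, Ch. II Def. 2.2.8 (i)).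

These are the ingredients of leaf holonomy (holonomy of a leaf path = composite of the
transition germs along a chain of plaques covering it; Hector–Hirsch A, Ch. III 2.2.1).

## References

* G. Hector, U. Hirsch, *Introduction to the Geometry of Foliations, Part A*, 2nd ed., Vieweg
  (1986), Ch. II 2.1.1, 2.1.4, Def. 2.2.8; Ch. III 1.3, 2.2.1 [HectorHirsch1986].
* C. Camacho, A. Lins Neto, *Geometric Theory of Foliations*, Birkhäuser (1985), Ch. IV §1
  [CamachoLinsNeto1985].

## Design notes

* Germs are handled as eventual equalities `=ᶠ[𝓝 t]` of globally defined real functions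
  (`transition e e' z : ℝ → ℝ` is total; only its germ at the base height is meaningful), and
  as elements of `Filter.Germ (𝓝 t) ℝ` where a locally constant germ-valued map is needed.
* General leaf model `B` and space `M`; no smoothness. Preconnectedness of pieces of plaques
  is assumed where the germ is transported along them.
-/
open scoped Topology
open Function Set Filter Topology

namespace Literature.Topology.FourManifolds

namespace Foliation

variable {B : Type*} [TopologicalSpace B] {M : Type*} [TopologicalSpace M]
variable {e e' e'' : OpenPartialHomeomorph M (B × ℝ)} {t : ℝ} {x y z w : M}

-- BODY
/-! ## Verticals of a flow box -/

/-- The **vertical** of the flow box `e` through the `B`-coordinate `b`: the transversal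
`τ ↦ e.symm (b, τ)` of the box (Hector–Hirsch A, Ch. I 4.1.1: the verticals of a
distinguished chart are transversals). [folklore] -/
def vertical (e : OpenPartialHomeomorph M (B × ℝ)) (b : B) : ℝ → M := fun τ ↦ plaqueMap e τ b

/-- Unfolding lemma for `vertical`. [folklore] -/
@[simp] theorem vertical_apply (e : OpenPartialHomeomorph M (B × ℝ)) (b : B) (τ : ℝ) :
    vertical e b τ = e.symm (b, τ) := rfl

/-- The vertical in terms of the plaque maps. [folklore] -/
theorem vertical_eq_plaqueMap (e : OpenPartialHomeomorph M (B × ℝ)) (b : B) (τ : ℝ) :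
    vertical e b τ = plaqueMap e τ b := rfl

variable (F : Foliation B M)

/-- The verticals of a flow box of a foliation are continuous. [folklore] -/
theorem continuous_vertical (he : e ∈ F.atlas) (b : B) : Continuous (vertical e b) :=
  (F.continuous_symm_of_mem he).comp (continuous_const.prodMk continuous_id)

/-- The flow box reads `(b, τ)` at the point of parameter `τ` of its vertical through `b`.
[folklore] -/
@[simp] theorem apply_vertical (he : e ∈ F.atlas) (b : B) (τ : ℝ) : e (vertical e b τ) = (b, τ) :=
  F.apply_plaqueMap he τ b

/-- Verticals run in the source of their flow box. [folklore] -/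
theorem vertical_mem_source (he : e ∈ F.atlas) (b : B) (τ : ℝ) : vertical e b τ ∈ e.source :=
  F.plaqueMap_mem_source he τ b

/-- The vertical crosses the plaque of height `τ` at the parameter `τ`. [folklore] -/
theorem vertical_mem_plaque (he : e ∈ F.atlas) (b : B) (τ : ℝ) : vertical e b τ ∈ plaque e τ :=
  F.plaqueMap_mem_plaque he τ b

/-- The verticals of a flow box of a foliation are injective. [folklore] -/
theorem injective_vertical (he : e ∈ F.atlas) (b : B) : Injective (vertical e b) := by
  intro τ₁ τ₂ h
  have := congrArg (fun z ↦ (e z).2) h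
  simpa only [F.apply_vertical he] using this

/-- The vertical through (the `B`-coordinate of) `z` passes through `z` at the height of `z`.
[folklore] -/
theorem vertical_height (hz : z ∈ e.source) : vertical e (e z).1 (e z).2 = z :=
  plaqueMap_fst_eq (mem_plaque_self hz)

/-- **Verticals are continuous transversals through their points**: the vertical of `e`
through `z ∈ e.source` eventually (for parameters near the height of `z`) lies in any given
neighbourhood of `z`. [folklore] -/
theorem eventually_vertical_mem (he : e ∈ F.atlas) (hz : z ∈ e.source) {U : Set M} (hU : U ∈ 𝓝 z) :
    ∀ᶠ τ in 𝓝 (e z).2, vertical e (e z).1 τ ∈ U :=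
  (F.continuous_vertical he (e z).1).continuousAt.preimage_mem_nhds (by rwa [vertical_height hz])

/-! ## The height transitions -/

/-- The **height transition** from the flow box `e` to the flow box `e'` at the point `z`: the
`e'`-height of the point at `e`-height `τ` on the vertical of `e` through `z`,
`τ ↦ h_{e'} (e.symm ((e z).1, τ))`. Its germ at the height of `z` is the local homeomorphism
`γ_{e e'}` of the foliated cocycle at `z` (Hector–Hirsch A, Ch. II 2.1.1 and 2.1.4: the changes
of distinguished charts have the form `(x, t) ↦ (α(x, t), γ(t))`, and the `γᵢⱼ` form a cocycle;
Ch. III 2.2.1: leaf holonomy is the composite of these germs along a chain of plaques). Only the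
germ at `(e z).2` is meaningful. [cite: HectorHirsch1986, Ch. II 2.1.4] -/
def transition (e e' : OpenPartialHomeomorph M (B × ℝ)) (z : M) : ℝ → ℝ :=
  fun τ ↦ (e' (vertical e (e z).1 τ)).2

/-- Unfolding lemma for `transition`. [folklore] -/
theorem transition_apply (e e' : OpenPartialHomeomorph M (B × ℝ)) (z : M) (τ : ℝ) :
    transition e e' z τ = (e' (vertical e (e z).1 τ)).2 := rfl

/-- **The transition from a box to itself is the identity.** [folklore] -/
@[simp] theorem transition_self (he : e ∈ F.atlas) (z : M) : transition e e z = id := by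
  funext τ
  rw [transition_apply, F.apply_vertical he, id]

/-- **At the height of `z` the transition takes the value `h_{e'}(z)`.** [folklore] -/
theorem transition_apply_height (e' : OpenPartialHomeomorph M (B × ℝ)) (hz : z ∈ e.source) :
    transition e e' z (e z).2 = (e' z).2 := by
  rw [transition_apply, vertical_height hz]

/-- The transition depends on `z` only through its `B`-coordinate in `e`: points on a common
vertical of `e` have the same transitions. [folklore] -/
theorem transition_eq_of_fst_eq (e' : OpenPartialHomeomorph M (B × ℝ)) (h : (e z).1 = (e w).1) :
    transition e e' z = transition e e' w := by
  funext τ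
  rw [transition_apply, transition_apply, h]

/-- **Continuity of the transition**: `transition e e' z` is continuous at every parameter `τ`
at which the vertical of `e` through `z` lies in the source of `e'`. [folklore] -/
theorem continuousAt_transition_of_mem (he : e ∈ F.atlas) {τ : ℝ}
    (hτ : vertical e (e z).1 τ ∈ e'.source) : ContinuousAt (transition e e' z) τ :=
  continuous_snd.continuousAt.comp
    ((e'.continuousAt hτ).comp (F.continuous_vertical he (e z).1).continuousAt)

/-- The transition `γ_{e e'}` at `z ∈ e.source ∩ e'.source` is continuous at the height of `z`.
[folklore] -/
theorem continuousAt_transition (he : e ∈ F.atlas) (hz : z ∈ e.source) (hz' : z ∈ e'.source) :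
    ContinuousAt (transition e e' z) (e z).2 :=
  F.continuousAt_transition_of_mem he (by rwa [vertical_height hz])

/-- The transition `γ_{e e'}` at `z` tends to `h_{e'}(z)` at the height of `z`. [folklore] -/
theorem tendsto_transition (he : e ∈ F.atlas) (hz : z ∈ e.source) (hz' : z ∈ e'.source) :
    Tendsto (transition e e' z) (𝓝 (e z).2) (𝓝 (e' z).2) := by
  have h := F.continuousAt_transition he hz hz'
  rwa [ContinuousAt, transition_apply_height e' hz] at h

/-! ## The transition germ is locally constant along the plaque -/

/-- **The transition germ is locally constant along the plaque** (the compatibility condition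
of the atlas, read on germs): for `z` on the plaque of `e` at height `t` and in `e'.source`,
every point `w` of that plaque near `z` (and in `e'.source`) has the same transition germ at
`t` as `z` — for parameters `τ` near `t` the points of the verticals through `z` and `w` at
height `τ` lie in a compatibility neighbourhood of `z` and have equal `e`-heights, hence equal
`e'`-heights. [cite: HectorHirsch1986, Ch. II 2.1.4] -/
theorem eventually_transition_eventuallyEq (he : e ∈ F.atlas) (he' : e' ∈ F.atlas)
    (hz : z ∈ plaque e t) (hz' : z ∈ e'.source) :
    ∀ᶠ w in 𝓝 z, w ∈ plaque e t → w ∈ e'.source →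
      transition e e' w =ᶠ[𝓝 t] transition e e' z := by
  obtain ⟨U, hU, hUe⟩ := F.locally_plaque e he e' he' z ⟨hz.1, hz'⟩
  obtain ⟨O, hOU, hOo, hzO⟩ := mem_nhds_iff.1 hU
  filter_upwards [hOo.mem_nhds hzO] with w hwO hw hw'
  -- the verticals through `z` and `w` eventually run in `O ∩ e'.source`
  have hz₁ : ∀ᶠ τ in 𝓝 t, vertical e (e z).1 τ ∈ O ∩ e'.source := by
    have h := F.eventually_vertical_mem he hz.1 (inter_mem (hOo.mem_nhds hzO) (e'.open_source.mem_nhds hz'))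
    rwa [hz.2] at h
  have hw₁ : ∀ᶠ τ in 𝓝 t, vertical e (e w).1 τ ∈ O ∩ e'.source := by
    have h := F.eventually_vertical_mem he hw.1 (inter_mem (hOo.mem_nhds hwO) (e'.open_source.mem_nhds hw'))
    rwa [hw.2] at h
  filter_upwards [hz₁, hw₁] with τ hτz hτw
  rw [transition_apply, transition_apply]
  refine hUe _ ⟨hOU hτw.1, F.vertical_mem_source he _ _, hτw.2⟩ _
    ⟨hOU hτz.1, F.vertical_mem_source he _ _, hτz.2⟩ ?_
  rw [F.apply_vertical he, F.apply_vertical he]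

/-- **The transition germ is constant along connected pieces of the plaque**: if `C` is a
preconnected subset of `plaque e t ∩ e'.source`, all points of `C` have the same transition
germ `γ_{e e'}` at `t` (a locally constant germ-valued function on a preconnected set is
constant). This is what makes the holonomy of a chain of plaques independent of the points
at which consecutive plaques are compared (Hector–Hirsch A, Ch. III 2.2.1; Camacho–Lins Neto,
Ch. IV §1, Lemma 1). [cite: HectorHirsch1986, Ch. III 2.2.1] -/
theorem transition_eventuallyEq_of_isPreconnected (he : e ∈ F.atlas) (he' : e' ∈ F.atlas)
    {C : Set M} (hC : IsPreconnected C) (hCt : C ⊆ plaque e t) (hC' : C ⊆ e'.source)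
    (hz : z ∈ C) (hw : w ∈ C) : transition e e' z =ᶠ[𝓝 t] transition e e' w := by
  -- the germ-valued map `q ↦ [transition e e' q]` is locally constant on `C`
  have key : IsLocallyConstant (fun q : C ↦ ((transition e e' (q : M) : ℝ → ℝ) : Germ (𝓝 t) ℝ)) := by
    refine (IsLocallyConstant.iff_eventually_eq _).2 fun q ↦ ?_
    have hq := F.eventually_transition_eventuallyEq he he' (hCt q.2) (hC' q.2)
    have hc : ContinuousAt (Subtype.val : C → M) q := continuous_subtype_val.continuousAt
    filter_upwards [hc.eventually hq] with v hv
    exact Germ.coe_eq.2 (hv (hCt v.2) (hC' v.2))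
  haveI := isPreconnected_iff_preconnectedSpace.1 hC
  exact Germ.coe_eq.1 (key.apply_eq_of_preconnectedSpace ⟨z, hz⟩ ⟨w, hw⟩)

/-! ## The cocycle identity -/

/-- **The cocycle identity** `γ_{e' e''} ∘ γ_{e e'} = γ_{e e''}` for the transition germs at a
point `z` common to three flow boxes of the atlas: for `τ` near the height of `z`, the point
`p` at height `τ` on the vertical of `e` through `z` and the point `p'` on the vertical of `e'`
through `z` at the `e'`-height of `p` have equal `e'`-heights and lie near `z`, hence have
equal `e''`-heights (Hector–Hirsch A, Ch. II 2.1.4, the cocycle condition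
`γᵢₖ = γᵢⱼ ∘ γⱼₖ`; Ch. III 1.3). [cite: HectorHirsch1986, Ch. II 2.1.4] -/
theorem transition_comp_eventuallyEq (he : e ∈ F.atlas) (he' : e' ∈ F.atlas) (he'' : e'' ∈ F.atlas)
    (hz : z ∈ e.source) (hz' : z ∈ e'.source) (hz'' : z ∈ e''.source) :
    transition e' e'' z ∘ transition e e' z =ᶠ[𝓝 (e z).2] transition e e'' z := by
  obtain ⟨U, hU, hUe⟩ := F.locally_plaque e' he' e'' he'' z ⟨hz', hz''⟩
  have hn : U ∩ (e'.source ∩ e''.source) ∈ 𝓝 z :=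
    inter_mem hU (inter_mem (e'.open_source.mem_nhds hz') (e''.open_source.mem_nhds hz''))
  -- the vertical of `e` through `z`, and the vertical of `e'` through `z` reparametrised by
  -- the transition, eventually run in `U ∩ e'.source ∩ e''.source`
  have h₁ : ∀ᶠ τ in 𝓝 (e z).2, vertical e (e z).1 τ ∈ U ∩ (e'.source ∩ e''.source) :=
    F.eventually_vertical_mem he hz hn
  have h₂ : ∀ᶠ τ in 𝓝 (e z).2,
      vertical e' (e' z).1 (transition e e' z τ) ∈ U ∩ (e'.source ∩ e''.source) :=
    (F.tendsto_transition he hz hz').eventually (F.eventually_vertical_mem he' hz' hn)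
  filter_upwards [h₁, h₂] with τ hτ₁ hτ₂
  simp only [comp_apply, transition_apply]
  refine hUe _ hτ₂ _ hτ₁ ?_
  rw [F.apply_vertical he']
  rfl

/-- **The inverse germ**: `γ_{e' e} ∘ γ_{e e'} = id` near the height of `z`. [folklore] -/
theorem transition_symm_comp_eventuallyEq (he : e ∈ F.atlas) (he' : e' ∈ F.atlas)
    (hz : z ∈ e.source) (hz' : z ∈ e'.source) :
    transition e' e z ∘ transition e e' z =ᶠ[𝓝 (e z).2] id := by
  have h := F.transition_comp_eventuallyEq he he' he hz hz' hz
  rwa [F.transition_self he] at h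

/-- The inverse germ, pointwise: eventually `γ_{e' e} (γ_{e e'} τ) = τ`. [folklore] -/
theorem eventually_transition_transition (he : e ∈ F.atlas) (he' : e' ∈ F.atlas)
    (hz : z ∈ e.source) (hz' : z ∈ e'.source) :
    ∀ᶠ τ in 𝓝 (e z).2, transition e' e z (transition e e' z τ) = τ :=
  F.transition_symm_comp_eventuallyEq he he' hz hz'

/-! ## The transition germs are germs of homeomorphisms -/

/-- **Local injectivity**: on a small interval around the height of `z`, the transition
`γ_{e e'}` at `z ∈ e.source ∩ e'.source` is injective — two points of the vertical of `e`
through `z`, near `z`, with equal `e'`-heights have equal `e`-heights (compatibility of the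
atlas for the pair `(e', e)`). [folklore] -/
theorem exists_injOn_transition (he : e ∈ F.atlas) (he' : e' ∈ F.atlas) (hz : z ∈ e.source)
    (hz' : z ∈ e'.source) :
    ∃ ε > (0 : ℝ), (∀ τ ∈ Ioo ((e z).2 - ε) ((e z).2 + ε), vertical e (e z).1 τ ∈ e'.source) ∧
      InjOn (transition e e' z) (Ioo ((e z).2 - ε) ((e z).2 + ε)) := by
  obtain ⟨U, hU, hUe⟩ := F.locally_plaque e' he' e he z ⟨hz', hz⟩
  have h₁ : ∀ᶠ τ in 𝓝 (e z).2, vertical e (e z).1 τ ∈ U ∩ e'.source :=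
    F.eventually_vertical_mem he hz (inter_mem hU (e'.open_source.mem_nhds hz'))
  obtain ⟨ε, hε, hball⟩ := Metric.eventually_nhds_iff_ball.1 h₁
  refine ⟨ε, hε, fun τ hτ ↦ (hball τ (by rwa [Real.ball_eq_Ioo])).2, fun τ₁ hτ₁ τ₂ hτ₂ h ↦ ?_⟩
  have h₁' := hball τ₁ (by rwa [Real.ball_eq_Ioo])
  have h₂' := hball τ₂ (by rwa [Real.ball_eq_Ioo])
  have key := hUe _ ⟨h₁'.1, h₁'.2, F.vertical_mem_source he _ _⟩ _
    ⟨h₂'.1, h₂'.2, F.vertical_mem_source he _ _⟩ h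
  simpa only [F.apply_vertical he] using key

/-- **The transition germs are germs of homeomorphisms of `ℝ`**: on a small interval around
the height of `z`, `γ_{e e'}` is continuous and injective, hence strictly monotone —
increasing or decreasing (Hector–Hirsch A, Ch. II 2.1.4: the `γᵢⱼ` are local homeomorphisms
of `ℝⁿ`, here `n = 1`). [cite: HectorHirsch1986, Ch. II 2.1.4] -/
theorem exists_strictMonoOn_or_strictAntiOn_transition (he : e ∈ F.atlas) (he' : e' ∈ F.atlas)
    (hz : z ∈ e.source) (hz' : z ∈ e'.source) :
    ∃ ε > (0 : ℝ), (∀ τ ∈ Ioo ((e z).2 - ε) ((e z).2 + ε), vertical e (e z).1 τ ∈ e'.source) ∧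
      (StrictMonoOn (transition e e' z) (Ioo ((e z).2 - ε) ((e z).2 + ε)) ∨
        StrictAntiOn (transition e e' z) (Ioo ((e z).2 - ε) ((e z).2 + ε))) := by
  obtain ⟨ε, hε, hsrc, hinj⟩ := F.exists_injOn_transition he he' hz hz'
  refine ⟨ε, hε, hsrc, ?_⟩
  have hc : ContinuousOn (transition e e' z) (Ioo ((e z).2 - ε) ((e z).2 + ε)) := fun τ hτ ↦
    (F.continuousAt_transition_of_mem he (hsrc τ hτ)).continuousWithinAt
  exact hc.strictMonoOn_of_injOn_Ioo (by linarith) hinj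

variable {F} in
/-- **For a transversely oriented atlas the transition germs are increasing**: on a small
interval around the height of `z ∈ e.source ∩ e'.source`, `γ_{e e'}` is strictly increasing
(Hector–Hirsch A, Ch. II Def. 2.2.8 (i): the `γᵢⱼ` are orientation preserving local
homeomorphisms of `ℝ`). [cite: HectorHirsch1986, Ch. II Def. 2.2.8] -/
theorem IsTransverselyOriented.exists_strictMonoOn_transition (ho : F.IsTransverselyOriented)
    (he : e ∈ F.atlas) (he' : e' ∈ F.atlas) (hz : z ∈ e.source) (hz' : z ∈ e'.source) :
    ∃ ε > (0 : ℝ), (∀ τ ∈ Ioo ((e z).2 - ε) ((e z).2 + ε), vertical e (e z).1 τ ∈ e'.source) ∧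
      StrictMonoOn (transition e e' z) (Ioo ((e z).2 - ε) ((e z).2 + ε)) := by
  obtain ⟨U, hU, hUe⟩ := ho e he e' he' z ⟨hz, hz'⟩
  have h₁ : ∀ᶠ τ in 𝓝 (e z).2, vertical e (e z).1 τ ∈ U ∩ e'.source :=
    F.eventually_vertical_mem he hz (inter_mem hU (e'.open_source.mem_nhds hz'))
  obtain ⟨ε, hε, hball⟩ := Metric.eventually_nhds_iff_ball.1 h₁
  refine ⟨ε, hε, fun τ hτ ↦ (hball τ (by rwa [Real.ball_eq_Ioo])).2, fun τ₁ hτ₁ τ₂ hτ₂ h ↦ ?_⟩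
  have h₁' := hball τ₁ (by rwa [Real.ball_eq_Ioo])
  have h₂' := hball τ₂ (by rwa [Real.ball_eq_Ioo])
  have key := hUe _ ⟨h₁'.1, F.vertical_mem_source he _ _, h₁'.2⟩ _
    ⟨h₂'.1, F.vertical_mem_source he _ _, h₂'.2⟩ (by simpa only [F.apply_vertical he] using h)
  simpa only [transition_apply] using key

/-- **The transition germ is surjective onto a neighbourhood of its value**: near `h_{e'}(z)`
every height is attained by `γ_{e e'}` at parameters near `h_e(z)` — indeed
`σ = γ_{e e'} (γ_{e' e} σ)` for `σ` near `h_{e'}(z)`, with `γ_{e' e} σ → h_e(z)`. In filter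
terms, `γ_{e e'}` maps the neighbourhood filter of `h_e(z)` *onto* that of `h_{e'}(z)`.
[folklore] -/
theorem map_nhds_transition (he : e ∈ F.atlas) (he' : e' ∈ F.atlas) (hz : z ∈ e.source)
    (hz' : z ∈ e'.source) : Filter.map (transition e e' z) (𝓝 (e z).2) = 𝓝 (e' z).2 := by
  refine le_antisymm (F.tendsto_transition he hz hz') fun s hs ↦ ?_
  -- `s ∋ᶠ τ` near `h_e(z)`; pull back along `γ_{e' e}`, which tends to `h_e(z)` and is a
  -- right inverse of `γ_{e e'}` near `h_{e'}(z)`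
  rw [Filter.mem_map] at hs
  have h₁ : ∀ᶠ σ in 𝓝 (e' z).2, transition e' e z σ ∈ transition e e' z ⁻¹' s :=
    (F.tendsto_transition he' hz' hz).eventually hs
  have h₂ : ∀ᶠ σ in 𝓝 (e' z).2, transition e e' z (transition e' e z σ) = σ :=
    F.eventually_transition_transition he' he hz' hz
  filter_upwards [h₁, h₂] with σ hσ₁ hσ₂
  rwa [mem_preimage, hσ₂] at hσ₁

/-- **Composition of germs along the cocycle**: eventual equalities may be composed through a
transition — if `f =ᶠ g` near `h_{e'}(z)` then `f ∘ γ_{e e'} =ᶠ g ∘ γ_{e e'}` near `h_e(z)`.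
[folklore] -/
theorem EventuallyEq.comp_transition {f g : ℝ → ℝ} (he : e ∈ F.atlas) (hz : z ∈ e.source)
    (hz' : z ∈ e'.source) (h : f =ᶠ[𝓝 (e' z).2] g) :
    f ∘ transition e e' z =ᶠ[𝓝 (e z).2] g ∘ transition e e' z :=
  h.comp_tendsto (F.tendsto_transition he hz hz')

end Foliation

end Literature.Topology.FourManifolds
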